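import Summits.Parity.BatemanHorn.Theorems.SelbergDelangeRigidityLSDRealSegmentTypeILocal
import Literature.NumberTheory.LFunctions.HallTenenbaumTheorem01
import Literature.NumberTheory.LFunctions.MertensElementary
import HarnessLib

/-!
# Route `SelbergDelangeRigidity`, crux `LSDRealSegment` (stmt-Parity-9770), line
# `product-anatomy-subcritical`: the tilted Rankin engine of `stub_tails` (helper file)

For real `1 ≤ y < 2` the weight `m ↦ y^{Ω(m)} · (smoothPart z m)^σ` (the un-capped tilt times a Rankin
factor on the `z`-smooth part) is a non-negative multiplicative function with `G(p) ≤ e y` once `σ log z ≤ 1`,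
and `G(p^ν)/p^ν = (G(p)/p)^ν ≤ (y p^{σ₀−1})^ν` once `σ ≤ σ₀ := (2 − y)/8`; so Hall–Tenenbaum's Theorem 01
(`Literature.NumberTheory.LFunctions.HallTenenbaum.theorem01`, PROVED) and the Euler-product bound (0.4) give
`Σ_{m ≤ N} y^{Ω(m)} (smoothPart z m)^σ ≤ C_y N (log N)^{y−1}` UNIFORMLY in `z ≥ 2`, `0 ≤ σ ≤ min(σ₀, 1/log z)`
(`tails_smoothTilt_sum_le`, the registered helper); at `σ = 0` this is the order of magnitude
`Σ_{m ≤ N} y^{Ω(m)} ≤ C_y N (log N)^{y−1}`.  The place where `y < 2` is used: the `p = 2` factor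
`Σ_ν (y 2^{σ−1})^ν` converges iff `y 2^{σ} < 2`.
-/

open Filter Finset Polynomial
open scoped BigOperators Topology Classical

namespace Summit.Parity.BatemanHorn.Cruxes.LSDRealSegment.ProductAnatomySubcritical

open Literature.NumberTheory.Sieve
open ArithmeticFunction (cardFactors)
noncomputable section

/-! ### The smooth part -/

/-- `smoothPart z 0 = 1` (junk input). [folklore] -/
@[simp] theorem smoothPart_zero (z : ℝ) : smoothPart z 0 = 1 := by simp [smoothPart]

/-- `smoothPart z 1 = 1`. [folklore] -/
@[simp] theorem smoothPart_one (z : ℝ) : smoothPart z 1 = 1 := by simp [smoothPart]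

/-- The smooth part is multiplicative on non-zero arguments (no coprimality needed). [folklore] -/
theorem smoothPart_mul (z : ℝ) {m n : ℕ} (hm : m ≠ 0) (hn : n ≠ 0) :
    smoothPart z (m * n) = smoothPart z m * smoothPart z n := by
  unfold smoothPart
  rw [Nat.factorization_mul hm hn, Finsupp.prod_add_index']
  · intro p
    simp
  · intro p a b
    split_ifs <;> simp [pow_add]

/-- The smooth part of a prime power. [folklore] -/
theorem smoothPart_prime_pow (z : ℝ) {p : ℕ} (hp : p.Prime) (ν : ℕ) :
    smoothPart z (p ^ ν) = if (p : ℝ) ≤ z then p ^ ν else 1 := by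
  unfold smoothPart
  rw [hp.factorization_pow, Finsupp.prod_single_index]
  split_ifs <;> simp

/-- The smooth part divides the number. [folklore] -/
theorem smoothPart_dvd (z : ℝ) (m : ℕ) : smoothPart z m ∣ m := by
  rcases eq_or_ne m 0 with rfl | hm
  · simp
  conv_rhs => rw [← Nat.prod_factorization_pow_eq_self hm]
  unfold smoothPart Finsupp.prod
  refine Finset.prod_dvd_prod_of_dvd _ _ fun p _ => ?_
  dsimp only
  split_ifs
  · exact dvd_rfl
  · exact one_dvd _

/-- The smooth part is at most the number (`m ≥ 1`). [folklore] -/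
theorem smoothPart_le (z : ℝ) {m : ℕ} (hm : m ≠ 0) : smoothPart z m ≤ m :=
  Nat.le_of_dvd (Nat.pos_of_ne_zero hm) (smoothPart_dvd z m)

/-! ### The tilted weight `G(m) = y^{Ω(m)} (smoothPart z m)^σ` -/

section Weight

variable {y z σ : ℝ} {G : ℕ → ℝ}

/-- `G(1) = 1`. [folklore] -/
theorem tilt_one (hG : ∀ m, G m = y ^ cardFactors m * (smoothPart z m : ℝ) ^ σ) : G 1 = 1 := by
  simp [hG]

/-- `G ≥ 0` for `y ≥ 0`. [folklore] -/
theorem tilt_nonneg (hG : ∀ m, G m = y ^ cardFactors m * (smoothPart z m : ℝ) ^ σ) (hy : 0 ≤ y) (m : ℕ) :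
    0 ≤ G m := by
  rw [hG]
  exact mul_nonneg (pow_nonneg hy _) (Real.rpow_nonneg (Nat.cast_nonneg _) _)

/-- `G` is multiplicative on coprime arguments. [folklore] -/
theorem tilt_mul_of_coprime (hG : ∀ m, G m = y ^ cardFactors m * (smoothPart z m : ℝ) ^ σ) {m n : ℕ}
    (h : m.Coprime n) : G (m * n) = G m * G n := by
  rcases eq_or_ne m 0 with rfl | hm
  · obtain rfl : n = 1 := by simpa using h
    simp [hG]
  rcases eq_or_ne n 0 with rfl | hn
  · obtain rfl : m = 1 := by simpa using h
    simp [hG]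
  rw [hG, hG m, hG n, ArithmeticFunction.cardFactors_mul hm hn, pow_add, smoothPart_mul z hm hn, Nat.cast_mul,
    Real.mul_rpow (Nat.cast_nonneg _) (Nat.cast_nonneg _)]
  ring

/-- `G(p) = y p^σ` for `p ≤ z` and `G(p) = y` for `p > z`. [folklore] -/
theorem tilt_prime (hG : ∀ m, G m = y ^ cardFactors m * (smoothPart z m : ℝ) ^ σ) {p : ℕ} (hp : p.Prime) :
    G p = y * if (p : ℝ) ≤ z then (p : ℝ) ^ σ else 1 := by
  rw [hG, ArithmeticFunction.cardFactors_apply_prime hp, pow_one]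
  have := smoothPart_prime_pow z hp 1
  rw [pow_one] at this
  rw [this]
  split_ifs <;> simp

/-- `G(p^ν) = G(p)^ν`. [folklore] -/
theorem tilt_prime_pow (hG : ∀ m, G m = y ^ cardFactors m * (smoothPart z m : ℝ) ^ σ) {p : ℕ} (hp : p.Prime)
    (ν : ℕ) : G (p ^ ν) = G p ^ ν := by
  rw [hG, tilt_prime hG hp, ArithmeticFunction.cardFactors_apply_prime_pow hp, smoothPart_prime_pow z hp, mul_pow]
  congr 1
  split_ifs
  · rw [Nat.cast_pow, ← Real.rpow_natCast, ← Real.rpow_natCast, ← Real.rpow_mul (Nat.cast_nonneg _),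
      ← Real.rpow_mul (Nat.cast_nonneg _), mul_comm]
  · simp

end Weight

/-! ### Local bounds at the primes -/

section Local

variable {y z σ : ℝ} {G : ℕ → ℝ}

/-- `p^σ ≤ e` for `p ≤ z` when `σ ≥ 0`, `σ log z ≤ 1`. [folklore] -/
theorem rpow_le_exp_one_of_le {p : ℕ} (hp : p.Prime) (hpz : (p : ℝ) ≤ z) (hσ : 0 ≤ σ)
    (hσz : σ * Real.log z ≤ 1) : (p : ℝ) ^ σ ≤ Real.exp 1 := by
  have hp0 : (0 : ℝ) < p := by exact_mod_cast hp.pos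
  rw [Real.rpow_def_of_pos hp0, Real.exp_le_exp]
  calc Real.log p * σ ≤ Real.log z * σ :=
        mul_le_mul_of_nonneg_right (Real.log_le_log hp0 hpz) hσ
    _ = σ * Real.log z := mul_comm _ _
    _ ≤ 1 := hσz

/-- `p^σ ≤ 1 + 2 σ log p` for `p ≤ z` when `σ ≥ 0`, `σ log z ≤ 1` (`e^t ≤ 1 + t + t²`, `t ≤ 1`). [folklore] -/
theorem rpow_le_one_add_of_le {p : ℕ} (hp : p.Prime) (hpz : (p : ℝ) ≤ z) (hσ : 0 ≤ σ)
    (hσz : σ * Real.log z ≤ 1) : (p : ℝ) ^ σ ≤ 1 + 2 * σ * Real.log p := by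
  have hp0 : (0 : ℝ) < p := by exact_mod_cast hp.pos
  have hlogp : 0 ≤ Real.log p := Real.log_nonneg (by exact_mod_cast hp.one_lt.le)
  set t : ℝ := σ * Real.log p with ht
  have ht0 : 0 ≤ t := mul_nonneg hσ hlogp
  have ht1 : t ≤ 1 := by
    calc t ≤ σ * Real.log z := by
          rw [ht]
          exact mul_le_mul_of_nonneg_left (Real.log_le_log hp0 hpz) hσ
      _ ≤ 1 := hσz
  have habs : |t| ≤ 1 := by rw [abs_of_nonneg ht0]; exact ht1
  have h := Real.abs_exp_sub_one_sub_id_le habs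
  have h2 : Real.exp t ≤ 1 + t + t ^ 2 := by
    have := (abs_le.mp h).2
    linarith
  have h3 : t ^ 2 ≤ t := by nlinarith
  rw [Real.rpow_def_of_pos hp0, show Real.log p * σ = t by rw [ht, mul_comm]]
  calc Real.exp t ≤ 1 + t + t ^ 2 := h2
    _ ≤ 1 + 2 * t := by linarith
    _ = 1 + 2 * σ * Real.log p := by rw [ht]; ring

/-- `G(p) ≤ e y`. [folklore] -/
theorem tilt_prime_le (hG : ∀ m, G m = y ^ cardFactors m * (smoothPart z m : ℝ) ^ σ) (hy : 0 ≤ y)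
    (hσ : 0 ≤ σ) (hσz : σ * Real.log z ≤ 1) {p : ℕ} (hp : p.Prime) : G p ≤ Real.exp 1 * y := by
  rw [tilt_prime hG hp]
  have h1 : (if (p : ℝ) ≤ z then (p : ℝ) ^ σ else 1) ≤ Real.exp 1 := by
    split_ifs with h
    · exact rpow_le_exp_one_of_le hp h hσ hσz
    · linarith [Real.add_one_le_exp (1 : ℝ)]
  calc y * (if (p : ℝ) ≤ z then (p : ℝ) ^ σ else 1) ≤ y * Real.exp 1 := mul_le_mul_of_nonneg_left h1 hy
    _ = Real.exp 1 * y := mul_comm _ _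

/-- `G(p)/p ≤ y p^{σ₀ − 1}` for `σ ≤ σ₀`. [folklore] -/
theorem tilt_prime_div_le (hG : ∀ m, G m = y ^ cardFactors m * (smoothPart z m : ℝ) ^ σ) (hy : 0 ≤ y)
    (hσ : 0 ≤ σ) {σ₀ : ℝ} (hσ₀ : σ ≤ σ₀) {p : ℕ} (hp : p.Prime) :
    G p / p ≤ y * (p : ℝ) ^ (σ₀ - 1) := by
  have hp1 : (1 : ℝ) ≤ p := by exact_mod_cast hp.one_lt.le
  have hp0 : (0 : ℝ) < p := by positivity
  rw [tilt_prime hG hp]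
  split_ifs with h
  · rw [mul_div_assoc, ← Real.rpow_sub_one hp0.ne']
    exact mul_le_mul_of_nonneg_left (Real.rpow_le_rpow_of_exponent_le hp1 (by linarith)) hy
  · rw [mul_one, div_eq_mul_inv, ← Real.rpow_neg_one]
    exact mul_le_mul_of_nonneg_left (Real.rpow_le_rpow_of_exponent_le hp1 (by linarith)) hy

/-- `G(p)/p ≤ y/p + 2yσ (log p)/p · [p ≤ z]`. [folklore] -/
theorem tilt_prime_div_le_add (hG : ∀ m, G m = y ^ cardFactors m * (smoothPart z m : ℝ) ^ σ) (hy : 0 ≤ y)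
    (hσ : 0 ≤ σ) (hσz : σ * Real.log z ≤ 1) {p : ℕ} (hp : p.Prime) :
    G p / p ≤ y / p + if (p : ℝ) ≤ z then 2 * y * σ * (Real.log p / p) else 0 := by
  have hp0 : (0 : ℝ) < p := by exact_mod_cast hp.pos
  rw [tilt_prime hG hp]
  split_ifs with h
  · have h1 := rpow_le_one_add_of_le hp h hσ hσz
    calc y * (p : ℝ) ^ σ / p ≤ y * (1 + 2 * σ * Real.log p) / p := by gcongr
      _ = y / p + 2 * y * σ * (Real.log p / p) := by
          field_simp
  · rw [mul_one, add_zero]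

/-- `y p^{e} ≤ y 2^{e}` for `e ≤ 0`, `p ≥ 2`. [folklore] -/
theorem mul_rpow_prime_le_two (hy : 0 ≤ y) {e : ℝ} (he : e ≤ 0) {p : ℕ} (hp : p.Prime) :
    y * (p : ℝ) ^ e ≤ y * (2 : ℝ) ^ e := by
  gcongr y * ?_
  exact Real.rpow_le_rpow_of_nonpos two_pos (by exact_mod_cast hp.two_le) he

/-- **Where `y < 2` is used**: `r₀ = y 2^{σ₀ − 1} < 1` for `σ₀ = (2 − y)/8`. [folklore] -/
theorem r0_lt_one (hy : 1 ≤ y) (hy2 : y < 2) : y * (2 : ℝ) ^ ((2 - y) / 8 - 1) < 1 := by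
  rw [Real.rpow_sub_one two_ne_zero]
  have hs : (2 : ℝ) ^ ((2 - y) / 8) < 2 / y := by
    rw [Real.rpow_def_of_pos two_pos]
    have hlog2 : Real.log 2 < 1 := by
      have := Real.log_two_lt_d9
      linarith
    have h1 : Real.log 2 * ((2 - y) / 8) < (2 - y) / 2 := by nlinarith
    have h2 : (2 - y) / 2 ≤ Real.log (2 / y) := by
      have h3 := Real.log_le_sub_one_of_pos (show 0 < y / 2 by linarith)
      rw [Real.log_div (by linarith) two_ne_zero] at h3
      rw [Real.log_div two_ne_zero (by linarith)]
      linarith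
    calc Real.exp (Real.log 2 * ((2 - y) / 8)) < Real.exp (Real.log (2 / y)) :=
          Real.exp_lt_exp.mpr (by linarith)
      _ = 2 / y := Real.exp_log (by positivity)
  have hy0 : 0 < y / 2 := by linarith
  calc y * ((2 : ℝ) ^ ((2 - y) / 8) / 2) = (y / 2) * (2 : ℝ) ^ ((2 - y) / 8) := by ring
    _ < (y / 2) * (2 / y) := by gcongr
    _ = 1 := by field_simp

/-- `(y p^{s−1})² log p ≤ 16 p^{−3/2}` for `y ≤ 2`, `s ≤ 1/8`. [folklore] -/
theorem rp_sq_mul_log_le (hy : 0 ≤ y) (hy2 : y ≤ 2) {s : ℝ} (hs : s ≤ 1 / 8) {p : ℕ} (hp : p.Prime) :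
    (y * (p : ℝ) ^ (s - 1)) ^ 2 * Real.log p ≤ 16 * (p : ℝ) ^ (-(3 / 2 : ℝ)) := by
  have hp1 : (1 : ℝ) ≤ p := by exact_mod_cast hp.one_lt.le
  have hp0 : (0 : ℝ) < p := by positivity
  have h1 : y * (p : ℝ) ^ (s - 1) ≤ 2 * (p : ℝ) ^ (-(7 / 8 : ℝ)) :=
    mul_le_mul hy2 (Real.rpow_le_rpow_of_exponent_le hp1 (by linarith)) (Real.rpow_nonneg hp0.le _)
      (by norm_num)
  have h2 : Real.log p ≤ 4 * (p : ℝ) ^ (1 / 4 : ℝ) := by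
    have := Real.log_le_rpow_div (Nat.cast_nonneg p) (by norm_num : (0 : ℝ) < 1 / 4)
    linarith
  have h0 : 0 ≤ y * (p : ℝ) ^ (s - 1) := by positivity
  calc (y * (p : ℝ) ^ (s - 1)) ^ 2 * Real.log p
      ≤ (2 * (p : ℝ) ^ (-(7 / 8 : ℝ))) ^ 2 * (4 * (p : ℝ) ^ (1 / 4 : ℝ)) :=
        mul_le_mul (pow_le_pow_left₀ h0 h1 2) h2 (Real.log_nonneg hp1) (by positivity)
    _ = 16 * (((p : ℝ) ^ (-(7 / 8 : ℝ))) ^ 2 * (p : ℝ) ^ (1 / 4 : ℝ)) := by ring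
    _ = 16 * (p : ℝ) ^ (-(3 / 2 : ℝ)) := by
        congr 1
        rw [← Real.rpow_natCast, ← Real.rpow_mul hp0.le, ← Real.rpow_add hp0]
        norm_num

/-- `(y p^{s−1})² ≤ 4 p^{−3/2}` for `y ≤ 2`, `s ≤ 1/8`. [folklore] -/
theorem rp_sq_le (hy : 0 ≤ y) (hy2 : y ≤ 2) {s : ℝ} (hs : s ≤ 1 / 8) {p : ℕ} (hp : p.Prime) :
    (y * (p : ℝ) ^ (s - 1)) ^ 2 ≤ 4 * (p : ℝ) ^ (-(3 / 2 : ℝ)) := by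
  have hp1 : (1 : ℝ) ≤ p := by exact_mod_cast hp.one_lt.le
  have hp0 : (0 : ℝ) < p := by positivity
  have h1 : y * (p : ℝ) ^ (s - 1) ≤ 2 * (p : ℝ) ^ (-(3 / 4 : ℝ)) :=
    mul_le_mul hy2 (Real.rpow_le_rpow_of_exponent_le hp1 (by linarith)) (Real.rpow_nonneg hp0.le _)
      (by norm_num)
  have h0 : 0 ≤ y * (p : ℝ) ^ (s - 1) := by positivity
  calc (y * (p : ℝ) ^ (s - 1)) ^ 2 ≤ (2 * (p : ℝ) ^ (-(3 / 4 : ℝ))) ^ 2 := pow_le_pow_left₀ h0 h1 2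
    _ = 4 * ((p : ℝ) ^ (-(3 / 4 : ℝ))) ^ 2 := by ring
    _ = 4 * (p : ℝ) ^ (-(3 / 2 : ℝ)) := by
        congr 1
        rw [← Real.rpow_natCast, ← Real.rpow_mul hp0.le]
        norm_num

end Local

/-! ### The two hypotheses of Hall–Tenenbaum's Theorem 01 -/

section Global

variable {y z σ : ℝ} {G : ℕ → ℝ}

/-- Hypothesis (0.5) of Theorem 01 for `G`: `Σ_{p ≤ w} G(p) log p ≤ (e y log 4) w` (Chebyshev). [folklore] -/
theorem tilt_hypA (hG : ∀ m, G m = y ^ cardFactors m * (smoothPart z m : ℝ) ^ σ) (hy : 0 ≤ y)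
    (hσ : 0 ≤ σ) (hσz : σ * Real.log z ≤ 1) {w : ℝ} (hw : 0 ≤ w) :
    ∑ p ∈ Nat.primesLE ⌊w⌋₊, G p * Real.log p ≤ Real.exp 1 * y * Real.log 4 * w := by
  calc ∑ p ∈ Nat.primesLE ⌊w⌋₊, G p * Real.log p
      ≤ ∑ p ∈ Nat.primesLE ⌊w⌋₊, Real.exp 1 * y * Real.log p :=
        Finset.sum_le_sum fun p hp => mul_le_mul_of_nonneg_right
          (tilt_prime_le hG hy hσ hσz (Nat.prime_of_mem_primesLE hp)) (Real.log_natCast_nonneg p)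
    _ = Real.exp 1 * y * Chebyshev.theta w := by rw [Chebyshev.theta_eq_sum_primesLE, Finset.mul_sum]
    _ ≤ Real.exp 1 * y * (Real.log 4 * w) :=
        mul_le_mul_of_nonneg_left (Chebyshev.theta_le_log4_mul_x hw) (by positivity)
    _ = Real.exp 1 * y * Real.log 4 * w := by ring

/-- Hypothesis (0.6) of Theorem 01 for `G`: the prime-power double sum is bounded, uniformly in `z, σ`
(`G(p^ν)/p^ν = (G(p)/p)^ν ≤ (y p^{σ₀−1})^ν`, geometric with ratio `≤ r₀ < 1`). [folklore] -/
theorem tilt_hypB (hG : ∀ m, G m = y ^ cardFactors m * (smoothPart z m : ℝ) ^ σ) (hy : 1 ≤ y) (hy2 : y < 2)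
    (hσ : 0 ≤ σ) (hσ₀ : σ ≤ (2 - y) / 8) (Y : ℕ) :
    ∑ p ∈ Nat.primesLE Y, ∑ ν ∈ Icc 2 Y, G (p ^ ν) / (p : ℝ) ^ ν * Real.log ((p : ℝ) ^ ν) ≤
      16 * (∑' j : ℕ, ((j : ℝ) + 2) * (y * (2 : ℝ) ^ ((2 - y) / 8 - 1)) ^ j) *
        ∑' n : ℕ, (n : ℝ) ^ (-(3 / 2 : ℝ)) := by
  set r₀ : ℝ := y * (2 : ℝ) ^ ((2 - y) / 8 - 1) with hr₀
  set T : ℝ := ∑' j : ℕ, ((j : ℝ) + 2) * r₀ ^ j with hT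
  set S : ℝ := ∑' n : ℕ, (n : ℝ) ^ (-(3 / 2 : ℝ)) with hS
  have hy0 : 0 ≤ y := by linarith
  have hr1 : r₀ < 1 := r0_lt_one hy hy2
  have hr0 : 0 ≤ r₀ := by positivity
  have hT0 : 0 ≤ T := tsum_nonneg fun j => by positivity
  have key : ∀ p : ℕ, p.Prime → ∑ ν ∈ Icc 2 Y, G (p ^ ν) / (p : ℝ) ^ ν * Real.log ((p : ℝ) ^ ν) ≤
      16 * T * (p : ℝ) ^ (-(3 / 2 : ℝ)) := by
    intro p hp
    have hp0 : (0 : ℝ) < p := by exact_mod_cast hp.pos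
    have hlogp : 0 ≤ Real.log p := Real.log_nonneg (by exact_mod_cast hp.one_lt.le)
    set u : ℝ := G p / p
    have hu0 : 0 ≤ u := div_nonneg (tilt_nonneg hG hy0 p) hp0.le
    have hur : u ≤ y * (p : ℝ) ^ ((2 - y) / 8 - 1) := tilt_prime_div_le hG hy0 hσ hσ₀ hp
    have hur0 : u ≤ r₀ := hur.trans (mul_rpow_prime_le_two hy0 (by linarith) hp)
    have hterm : ∀ ν ∈ Icc 2 Y, G (p ^ ν) / (p : ℝ) ^ ν * Real.log ((p : ℝ) ^ ν) =
        Real.log p * ((ν : ℝ) * u ^ ν) := by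
      intro ν _
      rw [tilt_prime_pow hG hp, ← div_pow, Real.log_pow]
      ring
    rw [Finset.sum_congr rfl hterm, ← Finset.mul_sum]
    calc Real.log p * ∑ ν ∈ Icc 2 Y, (ν : ℝ) * u ^ ν ≤ Real.log p * (u ^ 2 * T) :=
          mul_le_mul_of_nonneg_left (sum_Icc_mul_pow_le hu0 hur0 hr1 Y) hlogp
      _ ≤ Real.log p * ((y * (p : ℝ) ^ ((2 - y) / 8 - 1)) ^ 2 * T) := by gcongr
      _ = T * ((y * (p : ℝ) ^ ((2 - y) / 8 - 1)) ^ 2 * Real.log p) := by ring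
      _ ≤ T * (16 * (p : ℝ) ^ (-(3 / 2 : ℝ))) :=
          mul_le_mul_of_nonneg_left (rp_sq_mul_log_le hy0 hy2.le (by linarith) hp) hT0
      _ = 16 * T * (p : ℝ) ^ (-(3 / 2 : ℝ)) := by ring
  calc ∑ p ∈ Nat.primesLE Y, ∑ ν ∈ Icc 2 Y, G (p ^ ν) / (p : ℝ) ^ ν * Real.log ((p : ℝ) ^ ν)
      ≤ ∑ p ∈ Nat.primesLE Y, 16 * T * (p : ℝ) ^ (-(3 / 2 : ℝ)) :=
        Finset.sum_le_sum fun p hp => key p (Nat.prime_of_mem_primesLE hp)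
    _ = 16 * T * ∑ p ∈ Nat.primesLE Y, (p : ℝ) ^ (-(3 / 2 : ℝ)) := by rw [Finset.mul_sum]
    _ ≤ 16 * T * S := by
        gcongr
        exact (Real.summable_nat_rpow.mpr (by norm_num)).sum_le_tsum _ fun n _ =>
          Real.rpow_nonneg (Nat.cast_nonneg n) _

/-- The local factor `Σ_ν G(p^ν)/p^ν = (1 − G(p)/p)⁻¹` (a convergent geometric series). [folklore] -/
theorem tilt_local_tsum (hG : ∀ m, G m = y ^ cardFactors m * (smoothPart z m : ℝ) ^ σ) {p : ℕ} (hp : p.Prime)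
    (hu0 : 0 ≤ G p / p) (hu1 : G p / p < 1) :
    Summable (fun ν : ℕ => G (p ^ ν) / (p : ℝ) ^ ν) ∧ ∑' ν : ℕ, G (p ^ ν) / (p : ℝ) ^ ν = (1 - G p / p)⁻¹ := by
  have h : (fun ν : ℕ => G (p ^ ν) / (p : ℝ) ^ ν) = fun ν => (G p / p) ^ ν := by
    funext ν
    rw [tilt_prime_pow hG hp, div_pow]
  rw [h]
  exact ⟨summable_geometric_of_lt_one hu0 hu1, tsum_geometric_of_lt_one hu0 hu1⟩

end Global

/-! ### The registered helper -/

/-- **tails_tiltHypotheses** (registered helper of `stub_tails`, line `product-anatomy-subcritical`): for real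
`1 ≤ y < 2` there are `A`, `B` and `σ₀ > 0` such that, uniformly in `z` and `0 ≤ σ ≤ σ₀` with `σ log z ≤ 1`, the
multiplicative weight `G(m) = y^{Ω(m)} (smoothPart z m)^σ` satisfies the two hypotheses of Hall–Tenenbaum's
Theorem 01: (0.5) `Σ_{p ≤ w} G(p) log p ≤ A w` (`w ≥ 0`) and (0.6) `Σ_{p ≤ Y} Σ_{2 ≤ ν ≤ Y} G(p^ν) p^{−ν} log p^ν ≤ B`.
[folklore] -/
theorem tails_tiltHypotheses : ∀ y : ℝ, 1 ≤ y → y < 2 → ∃ A B σ₀ : ℝ, 0 < σ₀ ∧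
    ∀ (z σ : ℝ), 0 ≤ σ → σ ≤ σ₀ → σ * Real.log z ≤ 1 →
      (∀ w : ℝ, 0 ≤ w →
        ∑ p ∈ Nat.primesLE ⌊w⌋₊, y ^ cardFactors p * (smoothPart z p : ℝ) ^ σ * Real.log p ≤ A * w) ∧
      (∀ Y : ℕ, ∑ p ∈ Nat.primesLE Y, ∑ ν ∈ Icc 2 Y,
        y ^ cardFactors (p ^ ν) * (smoothPart z (p ^ ν) : ℝ) ^ σ / (p : ℝ) ^ ν * Real.log ((p : ℝ) ^ ν) ≤ B) := by
  intro y hy hy2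
  refine ⟨Real.exp 1 * y * Real.log 4,
    16 * (∑' j : ℕ, ((j : ℝ) + 2) * (y * (2 : ℝ) ^ ((2 - y) / 8 - 1)) ^ j) * ∑' n : ℕ, (n : ℝ) ^ (-(3 / 2 : ℝ)),
    (2 - y) / 8, by linarith, ?_⟩
  intro z σ hσ hσ₀ hσz
  have hG : ∀ m, (fun m => y ^ cardFactors m * (smoothPart z m : ℝ) ^ σ) m =
      y ^ cardFactors m * (smoothPart z m : ℝ) ^ σ := fun _ => rfl
  exact ⟨fun w hw => tilt_hypA hG (by linarith) hσ hσz hw, fun Y => tilt_hypB hG hy hy2 hσ hσ₀ Y⟩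

end

end Summit.Parity.BatemanHorn.Cruxes.LSDRealSegment.ProductAnatomySubcritical
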